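import Mathlib
import Summits.Ventures.PercRepro2.Defs
import Summits.Ventures.PercRepro2.Independence
import Summits.Ventures.PercRepro2.Harris
import Summits.Ventures.PercRepro2.Graph
import Summits.Ventures.PercRepro2.Exploration
import Summits.Ventures.PercRepro2.Events
import Summits.Ventures.PercRepro2.FourFunctions
import Summits.Ventures.PercRepro2.Induced
import Summits.Ventures.PercRepro2.Frontier
import Summits.Ventures.PercRepro2.ObsIndependence
import Summits.Ventures.PercRepro2.BHK
import Summits.Ventures.PercRepro2.BHKEvents
import Summits.Ventures.PercRepro2.OrderPreservation
import Summits.Ventures.PercRepro2.BHKAvoid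
import Summits.Ventures.PercRepro2.SameClusterAvoid
import Summits.Ventures.PercRepro2.CaseOneRegime
import Summits.Ventures.PercRepro2.CaseOnePos
import Summits.Ventures.PercRepro2.CaseOneJ11
import Summits.Ventures.PercRepro2.CaseOneRV
import Summits.Ventures.PercRepro2.CaseOnePendant
import Summits.Ventures.PercRepro2.CaseOnePendantAny
import Summits.Ventures.PercRepro2.CaseOnePendantNec
import Summits.Ventures.PercRepro2.CaseOneDWorld
import Summits.Ventures.PercRepro2.CaseOneDWorldPin
import Summits.Ventures.PercRepro2.HullDefs
import Summits.Ventures.PercRepro2.OneEdge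
import Summits.Ventures.PercRepro2.StarPattern
import Summits.Ventures.PercRepro2.HCov
import Summits.Ventures.PercRepro2.HCovSwap
import Summits.Ventures.PercRepro2.OddsLemma
import Summits.Ventures.PercRepro2.RV
import Summits.Ventures.PercRepro2.RVBridge

/-!
# `a₃` adjacent exactly to `o` and `b`: the two-edge pointwise facts and the mass identities
(blind cell PercRepro2, p1 g14; S5 §2.1 (K9) (j), proofs/P1-DWORLD.md §4e)

`a₃` has exactly two edges, `eo = {o, a₃}` and `eb = {b, a₃}` (`IsTwoMarkAt`). With both closed (`base`)
`a₃` is isolated; with one open it is a leaf (invisible among the other vertices); with both open it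
bridges `o` and `b` (`conn_both_iff`: `x ↔ y` iff `x ↔ y`, or `x ↔ o ∧ b ↔ y`, or `x ↔ b ∧ o ↔ y` in the
base). The masses of the Q-world `(ii)` are then explicit in the twelve base masses and the weights
`r_o = p(eo)`, `r_b = p(eb)` (`prob_Q_twoMark`, …, `prob_QABO_twoMark`, `Dpd_twoMark`, `Dpdo_twoMark`),
the input of the Bernstein certificate (P1-DWORLD.md §4e). Own code; standard axioms.
-/

namespace Summit.Ventures.PercRepro2

namespace CaseOne

section TwoMark
variable {V : Type*} {E : Type*} [DecidableEq E]

/-- **`a₃` adjacent exactly to `o` and `b`**: `eo = {o, a₃}`, `eb = {b, a₃}` are its only edges. -/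
structure IsTwoMarkAt (ends : E → Sym2 V) (o b a₃ : V) (eo eb : E) : Prop where
  /-- the edge to `o` -/
  ends_o : ends eo = s(o, a₃)
  /-- the edge to `b` -/
  ends_b : ends eb = s(b, a₃)
  /-- two different edges -/
  ne : eo ≠ eb
  /-- no other edge at `a₃` -/
  unique : ∀ e, a₃ ∈ ends e → e = eo ∨ e = eb
  /-- `o ≠ a₃` -/
  ne_o : o ≠ a₃
  /-- `b ≠ a₃` -/
  ne_b : b ≠ a₃

variable {ends : E → Sym2 V} {o b a₃ : V} {eo eb : E}

/-- The configuration with both edges at `a₃` closed. -/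
def base2 (eo eb : E) (ω : Config E) : Config E := Function.update (Function.update ω eo false) eb false

omit [DecidableEq E] in
/-- With every edge at `a₃` closed, `a₃` is isolated. -/
lemma isolated_of_closed (h : IsTwoMarkAt ends o b a₃ eo eb) {ω : Config E} (ho : ω eo = false)
    (hb : ω eb = false) {x : V} (hx : Conn ends ω a₃ x) : x = a₃ := by
  have hS : ∀ y ∈ ({a₃} : Set V), ∀ z, (openGraph ends ω).Adj y z → z ∈ ({a₃} : Set V) := by
    intro y hy z hyz
    rw [Set.mem_singleton_iff] at hy
    rw [hy] at hyz
    obtain ⟨_, e, he, hends⟩ := openGraph_adj.1 hyz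
    have h3 : a₃ ∈ ends e := by rw [hends]; exact Sym2.mem_mk_left _ _
    rcases h.unique e h3 with rfl | rfl
    · rw [ho] at he; exact Bool.noConfusion he
    · rw [hb] at he; exact Bool.noConfusion he
  exact mem_of_conn_of_closed hS (Set.mem_singleton a₃) hx

/-- `base2 ω` has both edges closed. -/
lemma base2_eo (ω : Config E) (hne : eo ≠ eb) : base2 eo eb ω eo = false := by
  simp [base2, Function.update_of_ne hne]

/-- `base2 ω` has both edges closed. -/
lemma base2_eb (ω : Config E) : base2 eo eb ω eb = false := by simp [base2]

/-- In the base, nothing but `a₃` is joined to `a₃`. -/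
lemma not_conn_base2 (h : IsTwoMarkAt ends o b a₃ eo eb) (ω : Config E) {x : V} (hx : x ≠ a₃) :
    ¬ Conn ends (base2 eo eb ω) x a₃ :=
  fun hc => hx (isolated_of_closed h (base2_eo ω h.ne) (base2_eb ω) (conn_symm hc))

/-- Opening `eo` from the base: a leaf at `o` — connections among vertices `≠ a₃` are unchanged. -/
lemma conn_open_o_iff (h : IsTwoMarkAt ends o b a₃ eo eb) (ω : Config E) {x y : V} (hx : x ≠ a₃)
    (hy : y ≠ a₃) :
    Conn ends (Function.update (base2 eo eb ω) eo true) x y ↔ Conn ends (base2 eo eb ω) x y := by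
  rw [OneEdge.conn_update_true_iff h.ends_o (base2 eo eb ω) x y]
  constructor
  · rintro (hc | ⟨_, hc⟩ | ⟨hc, _⟩)
    · exact hc
    · exact absurd (conn_symm hc) (not_conn_base2 h ω hy)
    · exact absurd hc (not_conn_base2 h ω hx)
  · exact fun hc => Or.inl hc

/-- Opening `eo` from the base: `x ↔ a₃` iff `x ↔ o` in the base. -/
lemma conn_open_o_a3_iff (h : IsTwoMarkAt ends o b a₃ eo eb) (ω : Config E) {x : V} (hx : x ≠ a₃) :
    Conn ends (Function.update (base2 eo eb ω) eo true) x a₃ ↔ Conn ends (base2 eo eb ω) x o := by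
  rw [OneEdge.conn_update_true_iff h.ends_o (base2 eo eb ω) x a₃]
  constructor
  · rintro (hc | ⟨hc, _⟩ | ⟨hc, _⟩)
    · exact absurd hc (not_conn_base2 h ω hx)
    · exact hc
    · exact absurd hc (not_conn_base2 h ω hx)
  · exact fun hc => Or.inr (Or.inl ⟨hc, conn_refl _ _ _⟩)

/-- Opening `eb` from the base: connections among vertices `≠ a₃` are unchanged. -/
lemma conn_open_b_iff (h : IsTwoMarkAt ends o b a₃ eo eb) (ω : Config E) {x y : V} (hx : x ≠ a₃)
    (hy : y ≠ a₃) :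
    Conn ends (Function.update (base2 eo eb ω) eb true) x y ↔ Conn ends (base2 eo eb ω) x y := by
  rw [OneEdge.conn_update_true_iff h.ends_b (base2 eo eb ω) x y]
  constructor
  · rintro (hc | ⟨_, hc⟩ | ⟨hc, _⟩)
    · exact hc
    · exact absurd (conn_symm hc) (not_conn_base2 h ω hy)
    · exact absurd hc (not_conn_base2 h ω hx)
  · exact fun hc => Or.inl hc

/-- Opening `eb` from the base: `x ↔ a₃` iff `x ↔ b` in the base. -/
lemma conn_open_b_a3_iff (h : IsTwoMarkAt ends o b a₃ eo eb) (ω : Config E) {x : V} (hx : x ≠ a₃) :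
    Conn ends (Function.update (base2 eo eb ω) eb true) x a₃ ↔ Conn ends (base2 eo eb ω) x b := by
  rw [OneEdge.conn_update_true_iff h.ends_b (base2 eo eb ω) x a₃]
  constructor
  · rintro (hc | ⟨hc, _⟩ | ⟨hc, _⟩)
    · exact absurd hc (not_conn_base2 h ω hx)
    · exact hc
    · exact absurd hc (not_conn_base2 h ω hx)
  · exact fun hc => Or.inr (Or.inl ⟨hc, conn_refl _ _ _⟩)

/-- **Both edges open: `a₃` bridges `o` and `b`** — for `x, y ≠ a₃`,
`x ↔ y` iff `x ↔ y`, or `x ↔ o ∧ b ↔ y`, or `x ↔ b ∧ o ↔ y`, all in the base. -/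
lemma conn_both_iff (h : IsTwoMarkAt ends o b a₃ eo eb) (ω : Config E) {x y : V} (hx : x ≠ a₃)
    (hy : y ≠ a₃) :
    Conn ends (Function.update (Function.update (base2 eo eb ω) eo true) eb true) x y ↔
      Conn ends (base2 eo eb ω) x y ∨
        (Conn ends (base2 eo eb ω) x o ∧ Conn ends (base2 eo eb ω) b y) ∨
        (Conn ends (base2 eo eb ω) x b ∧ Conn ends (base2 eo eb ω) o y) := by
  set ω₁ := Function.update (base2 eo eb ω) eo true with hω₁
  rw [OneEdge.conn_update_true_iff h.ends_b ω₁ x y, conn_open_o_iff h ω hx hy]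
  have e1 : Conn ends ω₁ x b ↔ Conn ends (base2 eo eb ω) x b := conn_open_o_iff h ω hx h.ne_b
  have e2 : Conn ends ω₁ a₃ y ↔ Conn ends (base2 eo eb ω) o y := by
    have := conn_open_o_a3_iff h ω hy
    exact ⟨fun hc => conn_symm (this.1 (conn_symm hc)), fun hc => conn_symm (this.2 (conn_symm hc))⟩
  have e3 : Conn ends ω₁ x a₃ ↔ Conn ends (base2 eo eb ω) x o := conn_open_o_a3_iff h ω hx
  have e4 : Conn ends ω₁ b y ↔ Conn ends (base2 eo eb ω) b y := conn_open_o_iff h ω h.ne_b hy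
  rw [e1, e2, e3, e4]
  tauto

/-- **Both edges open: `x ↔ a₃`** iff `x ↔ o` or `x ↔ b` in the base. -/
lemma conn_both_a3_iff (h : IsTwoMarkAt ends o b a₃ eo eb) (ω : Config E) {x : V} (hx : x ≠ a₃) :
    Conn ends (Function.update (Function.update (base2 eo eb ω) eo true) eb true) x a₃ ↔
      Conn ends (base2 eo eb ω) x o ∨ Conn ends (base2 eo eb ω) x b := by
  set ω₁ := Function.update (base2 eo eb ω) eo true with hω₁
  rw [OneEdge.conn_update_true_iff h.ends_b ω₁ x a₃]
  have e1 : Conn ends ω₁ x b ↔ Conn ends (base2 eo eb ω) x b := conn_open_o_iff h ω hx h.ne_b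
  have e3 : Conn ends ω₁ x a₃ ↔ Conn ends (base2 eo eb ω) x o := conn_open_o_a3_iff h ω hx
  constructor
  · rintro (hc | ⟨hc, _⟩ | ⟨hc, _⟩)
    · exact Or.inl (e3.1 hc)
    · exact Or.inr (e1.1 hc)
    · exact Or.inl (e3.1 hc)
  · rintro (hc | hc)
    · exact Or.inl (e3.2 hc)
    · exact Or.inr (Or.inl ⟨e1.2 hc, conn_refl _ _ _⟩)

end TwoMark

/-! ## The double pinning and the support congruence -/

section Pin2
variable {E : Type*} [Fintype E] [DecidableEq E] {R : Type*} [CommRing R]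

/-- Both edges set to prescribed states. -/
def openCC (eo eb : E) (c c' : Bool) (ω : Config E) : Config E :=
  Function.update (Function.update ω eo c) eb c'

omit [Fintype E] in
/-- Re-pinning the base is the same as pinning directly. -/
lemma openCC_base2 {eo eb : E} (hne : eo ≠ eb) (c c' : Bool) (ω : Config E) :
    openCC eo eb c c' (Function.update (Function.update ω eo false) eb false) =
      Function.update (Function.update ω eb c') eo c := by
  funext e
  by_cases he : e = eb
  · rw [he]
    simp only [openCC, Function.update_self]
    rw [Function.update_of_ne (Ne.symm hne), Function.update_self]
  · by_cases ho : e = eo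
    · rw [ho]
      simp only [openCC]
      rw [Function.update_of_ne hne, Function.update_self, Function.update_self]
    · simp only [openCC]
      rw [Function.update_of_ne he, Function.update_of_ne ho, Function.update_of_ne he,
        Function.update_of_ne ho, Function.update_of_ne ho, Function.update_of_ne he]

/-- **The double pinning**: `E_p[f]` as the four-term mixture over the states of `eo, eb`, each term
an expectation under `p[eo ↦ 0][eb ↦ 0]` of `f` at the re-opened configuration. -/
theorem expect_twoPin (p : E → R) {eo eb : E} (hne : eo ≠ eb) (f : Config E → R) :
    expect p f =
      p eo * (p eb * expect (Function.update (Function.update p eo 0) eb 0)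
            (fun ω => f (openCC eo eb true true ω)) +
          (1 - p eb) * expect (Function.update (Function.update p eo 0) eb 0)
            (fun ω => f (openCC eo eb true false ω))) +
      (1 - p eo) * (p eb * expect (Function.update (Function.update p eo 0) eb 0)
            (fun ω => f (openCC eo eb false true ω)) +
          (1 - p eb) * expect (Function.update (Function.update p eo 0) eb 0)
            (fun ω => f (openCC eo eb false false ω))) := by
  have key : ∀ c c' : Bool, expect (Function.update (Function.update p eo 0) eb 0)
      (fun ω => f (openCC eo eb c c' ω)) =
      expect p (fun ω => f (Function.update (Function.update ω eb c') eo c)) := by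
    intro c c'
    rw [expect_update_zero, expect_update_zero]
    congr 1
    funext ω
    rw [openCC_base2 hne]
  rw [key, key, key, key]
  rw [expect_eq_update_pin p f eo]
  have h1 := expect_eq_update_pin p (fun ω => f (Function.update ω eo true)) eb
  have h0 := expect_eq_update_pin p (fun ω => f (Function.update ω eo false)) eb
  rw [h1, h0]

/-- Functions agreeing where both pinned edges are closed have the same `p[eo ↦ 0][eb ↦ 0]`-expectation. -/
lemma expect_p00_congr (p : E → R) (eo eb : E) (f g : Config E → R)
    (hfg : ∀ ω, ω eo = false → ω eb = false → f ω = g ω) :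
    expect (Function.update (Function.update p eo 0) eb 0) f =
      expect (Function.update (Function.update p eo 0) eb 0) g := by
  unfold expect
  refine Finset.sum_congr rfl fun ω _ => ?_
  by_cases ho : ω eo = false
  · by_cases hb : ω eb = false
    · rw [hfg ω ho hb]
    · have hb' : ω eb = true := by simpa using hb
      rw [weight_update_zero_of_eq_true _ hb']
      ring
  · have ho' : ω eo = true := by simpa using ho
    have hw : weight (Function.update (Function.update p eo 0) eb 0) ω = 0 := by
      unfold weight
      refine Finset.prod_eq_zero (Finset.mem_univ eo) ?_
      have h0 : Function.update (Function.update p eo 0) eb 0 eo = 0 := by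
        by_cases heb : eo = eb
        · rw [heb, Function.update_self]
        · rw [Function.update_of_ne heb, Function.update_self]
      rw [h0, ho']
      simp [edgeFactor]
    rw [hw]
    ring

end Pin2

/-! ## The configurations with both edges closed: the opened versions -/

section Closed
variable {V : Type*} {E : Type*} [DecidableEq E] {ends : E → Sym2 V} {o b a₃ : V} {eo eb : E}

/-- A configuration with both edges closed is its own base. -/
lemma base2_eq_self {ω : Config E} (ho : ω eo = false) (hb : ω eb = false) : base2 eo eb ω = ω := by
  funext e
  unfold base2
  by_cases he : e = eb
  · rw [he, Function.update_self, hb]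
  · rw [Function.update_of_ne he]
    by_cases ho' : e = eo
    · rw [ho', Function.update_self, ho]
    · rw [Function.update_of_ne ho']

/-- `openCC true false` of a closed configuration is the base with `eo` opened. -/
lemma openCC_tf (hne : eo ≠ eb) {ω : Config E} (ho : ω eo = false) (hb : ω eb = false) :
    openCC eo eb true false ω = Function.update (base2 eo eb ω) eo true := by
  rw [base2_eq_self ho hb]
  funext e
  unfold openCC
  by_cases he : e = eb
  · rw [he, Function.update_self, Function.update_of_ne (Ne.symm hne), hb]
  · rw [Function.update_of_ne he]

/-- `openCC false true` of a closed configuration is the base with `eb` opened. -/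
lemma openCC_ft {ω : Config E} (ho : ω eo = false) (hb : ω eb = false) :
    openCC eo eb false true ω = Function.update (base2 eo eb ω) eb true := by
  rw [base2_eq_self ho hb]
  funext e
  unfold openCC
  by_cases he : e = eb
  · rw [he, Function.update_self, Function.update_self]
  · rw [Function.update_of_ne he, Function.update_of_ne he]
    by_cases ho' : e = eo
    · rw [ho', Function.update_self, ho]
    · rw [Function.update_of_ne ho']

/-- `openCC true true` of a closed configuration is the base with both edges opened. -/
lemma openCC_tt {ω : Config E} (ho : ω eo = false) (hb : ω eb = false) :
    openCC eo eb true true ω = Function.update (Function.update (base2 eo eb ω) eo true) eb true := by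
  rw [base2_eq_self ho hb]
  rfl

/-- `openCC false false` of a closed configuration is itself (the base). -/
lemma openCC_ff {ω : Config E} (ho : ω eo = false) (hb : ω eb = false) :
    openCC eo eb false false ω = base2 eo eb ω := by
  rw [base2_eq_self ho hb]
  funext e
  unfold openCC
  by_cases he : e = eb
  · rw [he, Function.update_self, hb]
  · rw [Function.update_of_ne he]
    by_cases ho' : e = eo
    · rw [ho', Function.update_self, ho]
    · rw [Function.update_of_ne ho']

end Closed

end CaseOne

end Summit.Ventures.PercRepro2
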